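import Summits.QuantumFields.YangMills.Theorems.BalabanUVNodesK0Stub1TouchedCentresOfDomains
import Summits.QuantumFields.YangMills.Theorems.UnitScaleTiltProp8ChartLocality
import Literature.MathematicalPhysics.QuantumFieldTheory.Balaban1983to89.Node00.GenSetVsLamBond

/-!
# K0⁷ STUB 1 (`stub_prop8StepCoP13`), sub-target S4a — **THE MULTI-LEVEL FLAT AVERAGING DICTIONARY** (file 2∕2): for a nested family of domains `Ω₁ ⊃ … ⊃ Ω_k`
# ([B6] (2.1)–(2.4), `B6SectADomainsV1.Domains`) with the collar property, PRINT's multi-level kernel `{Z : Q_jZ(c) = 0 at every index bond (j,c)}`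
# ([B6] (2.6)∕(2.20); = `ker Q_V` of this seat's (128)∕(158) files) is carried into the RECORD's multi-level kernel `{Y : Q_j(1)Y(c) = 0 at every index bond}`
# (dag-n07-w1's `Q_j(1) = Node00.dIterL j 1`, the operator of dag-n07-w2's multi-scale chart kernel `fderiv_msChart_apply_eq_zero_iff`) by ONE skew-Hermitian ∕
# 𝔰𝔲(N)-valued fine gauge function `ν = TZ` serving ALL LEVELS AT ONCE, `T` complex-linear — the hierarchical comb functionals `Λ_j(Z)` read at the touched `j`-centres

Cell `pub-ymgap`, width seat `pub-ymgap-k0-s1-w1` g5 (CLAIM-1 ∕ INTENT-1, bus I.31516 ∕ I.31580; trigger (t1)(i) of HANDOFF § g4, fired on the lane owner's side by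
dag-n07-e g20 I.31136: road (a) «heart in matched `ker Q_V`, `h128` displayed, kernel transfer via the dictionary + a corrected current» and the (Q2) `h128`
transfer chain at the record 44d (`ker Q_V(D″) ⊆ T^{print}_{genSet}`, print currency) → THIS (print → record, all levels) → the record's (127)).
`--kind proof --supports stmt-QuantumFields-20541 --as helper`; count-neutral.  File 1∕2 = `…K0Stub1TouchedCentresOfDomains` (the collision lemma).
[15] = [Balaban1985Variational]; [B5] = [Balaban1984PropagatorsI]; [B6] = [Balaban1984PropagatorsII]; [B7] = [Balaban1985Averaging]; [I] = [Balaban1987RG1].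

WHY.  p602768 (`…K0Stub1FlatAveragingDictionary`) §3 is the ONE-LEVEL dictionary.  The heart of [15] Sect. F and dag-n07-w2's chart live on a MULTI-LEVEL family
(`Q_j` on `Λ_j`, `j = 0, …, k`; [15] (150) «more restrictive functional conditions» `Ω′_j`), and every junction between the record's criticality (kernel of the
`Q_j(1)`) and the heart's matched test class `ker Q_V` needs ONE gauge function for all levels.  Construction: `(TZ)(x) := Λ_jZ(y)` if `x = embIter j y` is the centre
of a touched `j`-site (end-point of an index bond), `0` otherwise; well defined on print's kernel by file 1's collision lemma; then at an index bond `c` of level `j`: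
`Q_j(1)(Z + ∂TZ)(c) = [L^j·Q_jZ(c) − ∂Λ_jZ(c)] + ∂(TZ∘embIter j)(c) = 0 − ∂Λ_jZ(c) + ∂Λ_jZ(c) = 0` (p602768 `dIterL_one_eq_sub_comb`, `dIterL_one_grad`).

WHAT IS PROVED (sorry-free; no definition; axioms standard; `M = M_N(ℂ)`; «skew» = `Y_b⋆ = −Y_b`; INDEX READING `I` with (hI₁)∕(hI₂) as in file 1).
* §3 ★★★ `exists_linear_gauge_dIterL_one_eq_zero_of_bondAvgIter_eq_zero` — for every nested `D` with the collar property and every index reading `I`: a ℂ-LINEAR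
  `T : (PBond P 0 → M) →ₗ[ℂ] (Site P 0 → M)`, skew ↦ skew, 𝔰𝔲(N) ↦ 𝔰𝔲(N), supported on the touched centres (dichotomy: `(TZ)(x) = 0` or `= Λ_jZ(y)` for a touched
  `(j, y)` centred at `x`), SUP LETTER `‖(TZ)(x)‖ ≤ (d+2)·L^{k+1}·sup‖Z‖` (file 1 `norm_combFamily_le'`), `(TZ)(embIter j y) = Λ_jZ(y)` at every touched `(j, y)` for EVERY
  comb family `Λ` and every `Z` in print's kernel, and **`Q_j(1)(Z + ∂(TZ))(c) = 0` at every index bond `(j, c)`** for every skew `Z` in print's kernel;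
  ★★ `exists_gauge_dIterL_one_eq_zero_of_bondAvgIter_eq_zero_levels` (∃ν form, p602768 §3 shape); ★★ `apply_eq_neg_apply_grad_of_annihilates_record_kernel` (an additive
  functional vanishing on the RECORD's skew multi-level kernel takes the value `−ℓ(∂TZ)` on print's: the exact part of the (127)_record ⇒ (127)_print junction, source of
  the corrected current) and ★ `annihilates_print_kernel_of_record_kernel` (gauge-blind readers: the multi-level edition of p602768 `annihilates_ker_dIterL_one_iff`, one direction).
* §4 readings: `lamSite_or_of_lamBond`, ★★ `…_of_constr_zero` ([B6] (2.3) `LamBond` = `BondIdx D`), ★★ `…_of_QV_eq_zero` (p595460's kernel-formula letter `Q_V`, via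
  p602768 §1 `QV_eq_zero_iff`), `genSet_congr_pos`, ★★ `…_genSet` ∕ `…_genSet_of_agree` (B15 reading (b) `bondsOf (genSet Ω k j)` for any region sequence `Ω`
  agreeing with `{x | D.InOm i x}` at `1 ≤ i ≤ k` — the record's `s.Ω` once dag-n07-e's `domainsOfSeq s` (44c) lands), ★ `…_of_adm22` twins (collar ⇐ `Adm22`, `2L ≤ R·M+1`).

HONEST SCOPE.  Lattice bookkeeping at the FLAT background `U₀ = 1` only, over kernel-checked identities (p602768 §2, UST `ChartHInvComb`, [B6] (2.1)–(2.4) as typed);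
NO estimate (no size letter for `T` is stated here); the converse direction (record's kernel → print's, far-corner masses at all levels) and the corrected-current
junction (127) ⇒ `h128` (transpose of `∂∘T`) are NOT in this file; nothing of Bałaban's analysis asserted; `stub_prop8StepCoP13` ∕ K0⁷ NOT closed; N07 NOT discharged;
counts unmoved (28∕28 · 5∕27); one finite 𝕋⁴ programme at fixed ε — R4 closes the conditional finite-𝕋⁴ rung `BalabanLadder.UV` only, never the summit; the YM mass gap
(Clay) is NOT proved by any of this; nothing continuum ∕ ℝ⁴ ∕ OS.  No `sorry`, no `def`, no `instance`, no `notation`.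

References: [B6] (2.1)–(2.4), (2.6)–(2.7) p.224, (2.20) p.226; [15] (4) p.278, (44)–(47) p.285, (127)–(128) p.297, (150)–(153) p.301, (156)–(157) p.302;
[B5] (1.18)–(1.20) p.20; [B7] (11) p.18, (62) p.28; [I] (0.1)–(0.4) pp.251–253; [Balaban1988Convergent] (2.2) p.255, (2.10) p.256.
-/

set_option autoImplicit false
noncomputable section
open scoped BigOperators Matrix

namespace Summit.QuantumFields.YangMills.Theorems.K0Stub1FlatAveragingDictionaryLevels

open scoped Matrix.Norms.L2Operator
open Literature.MathematicalPhysics.QuantumFieldTheory.Balaban1983to89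
open LatticeFieldCalculus (bondAvgIter)
open BlockAveragingEMLLinearised (combMean)
open B5Eq118OneStroke (iterBlockOf iterBlockOf_zero iterBlockOf_succ)
open B15DeterminingSets (embIter genSet bondsOf pts gammaRegion)
open T4AdjointCovarianceUnitary (lieSU)
open B6SectADomainsV1 (Domains)
open Node00 (dIterL)
open Summit.QuantumFields.YangMills.Theorems.ChartHInv (exists_combFamily combFamily_add combFamily_const_smul)
open Summit.QuantumFields.YangMills.Theorems.K0Stub1FlatAveragingDictionary (combFamily_skew combFamily_mem_lieSU dIterL_one_eq_sub_comb dIterL_one_grad)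
open Summit.QuantumFields.YangMills.Theorems.K0Stub1TouchedCentresOfDomains (embIter_injective combFamily_unique comb_eq_of_collision)
open Summit.QuantumFields.YangMills.Theorems.FlatCubeOpsText (Adm22)

variable {P : Params} {N : ℕ}

/-! ## §3  THE MULTI-LEVEL DICTIONARY: print's kernel → the record's kernel by ONE gauge function, all levels at once -/

section Main

variable [NeZero N] (D : Domains P)
  (hcollar : ∀ (i : ℕ) (e : PBond P (i + 1)), D.LamBond (i + 1) e → ∀ z : Site P i, (blockOf z = e.src ∨ blockOf z = e.tgt) → z ∈ D.Om i)
  (I : (j : ℕ) → PBond P j → Prop)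
  (hI₁ : ∀ (j : ℕ) (b : PBond P j), I j b → D.LamSite j b.src ∨ D.LamSite j b.tgt)
  (hI₂ : ∀ (j : ℕ) (c : PBond P j), D.LamSite j c.src → D.LamSite j c.tgt → I j c)

include hcollar hI₁ hI₂ in
/-- ★★★ **THE MULTI-LEVEL FLAT AVERAGING DICTIONARY (linear form).**  For every nested family `D` with the collar property and every index reading `I` there is a
COMPLEX-LINEAR map `T` from fine bond fields to fine gauge functions — `(TZ)(x) = Λ_jZ(y)` at the centre `x = embIter j y` of every touched `j`-site (end-point of an
index bond), `0` at every other fine site — such that: `T` maps skew-Hermitian fields to skew-Hermitian gauge functions and `𝔰𝔲(N)`-valued to `𝔰𝔲(N)`-valued ones, and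
for every SKEW `Z` IN PRINT's MULTI-LEVEL KERNEL (`(Q_jZ)(c) = 0` at every index bond `(j,c)`, [B6] (2.6)∕(2.20) with `B = 0`) the regauged field lies in the RECORD's
multi-level kernel: **`Q_j(1)(Z + ∂(TZ))(c) = 0` at every index bond `(j, c)`, ALL LEVELS AT ONCE** (`Q_j(1) = dIterL j 1`, dag-n07-w1), and `(TZ)(embIter j y) = Λ_jZ(y)`
for EVERY comb family `Λ`. [cite: Balaban1985Variational, (4) p.278, (44)-(47) p.285, (150) p.301; Balaban1984PropagatorsII, (2.3)-(2.4) p.224, (2.20) p.226; Balaban1985Averaging, (11) p.18, (62) p.28] -/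
theorem exists_linear_gauge_dIterL_one_eq_zero_of_bondAvgIter_eq_zero :
    ∃ T : (PBond P 0 → Matrix (Fin N) (Fin N) ℂ) →ₗ[ℂ] (Site P 0 → Matrix (Fin N) (Fin N) ℂ),
      (∀ Z : PBond P 0 → Matrix (Fin N) (Fin N) ℂ, (∀ b, star (Z b) = -Z b) → ∀ x, star (T Z x) = -T Z x) ∧
      (∀ Z : PBond P 0 → Matrix (Fin N) (Fin N) ℂ, (∀ b, Z b ∈ lieSU (Fin N)) → ∀ x, T Z x ∈ lieSU (Fin N)) ∧
      (∀ (Z : PBond P 0 → Matrix (Fin N) (Fin N) ℂ) (x : Site P 0),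
        (¬ ∃ (j : ℕ) (b : PBond P j) (y : Site P j), I j b ∧ (y = b.src ∨ y = b.tgt) ∧ embIter j y = x) → T Z x = 0) ∧
      (∀ (Λ : (i : ℕ) → (PBond P 0 → Matrix (Fin N) (Fin N) ℂ) → Site P i → Matrix (Fin N) (Fin N) ℂ),
        (∀ Y y, Λ 0 Y y = 0) →
        (∀ (i : ℕ) (Y : PBond P 0 → Matrix (Fin N) (Fin N) ℂ) (y : Site P (i + 1)),
          Λ (i + 1) Y y = (P.L ^ i : ℕ) • combMean (bondAvgIter i Y) y + Λ i Y (emb y)) →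
        ∀ Z : PBond P 0 → Matrix (Fin N) (Fin N) ℂ, (∀ (j : ℕ) (c : PBond P j), I j c → bondAvgIter j Z c = 0) →
          ∀ (j : ℕ) (b : PBond P j) (y : Site P j), I j b → (y = b.src ∨ y = b.tgt) → T Z (embIter j y) = Λ j Z y) ∧
      (∀ (Λ : (i : ℕ) → (PBond P 0 → Matrix (Fin N) (Fin N) ℂ) → Site P i → Matrix (Fin N) (Fin N) ℂ),
        (∀ Y y, Λ 0 Y y = 0) →
        (∀ (i : ℕ) (Y : PBond P 0 → Matrix (Fin N) (Fin N) ℂ) (y : Site P (i + 1)),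
          Λ (i + 1) Y y = (P.L ^ i : ℕ) • combMean (bondAvgIter i Y) y + Λ i Y (emb y)) →
        ∀ (Z : PBond P 0 → Matrix (Fin N) (Fin N) ℂ) (x : Site P 0), T Z x = 0 ∨
          ∃ (j : ℕ) (b : PBond P j) (y : Site P j), I j b ∧ (y = b.src ∨ y = b.tgt) ∧ embIter j y = x ∧ T Z x = Λ j Z y) ∧
      (∀ (Z : PBond P 0 → Matrix (Fin N) (Fin N) ℂ) (s : ℝ), 0 ≤ s → (∀ b, ‖Z b‖ ≤ s) →
        ∀ x, ‖T Z x‖ ≤ ((P.d + 2 : ℕ) : ℝ) * (P.L : ℝ) ^ (D.k + 1) * s) ∧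
      (∀ Z : PBond P 0 → Matrix (Fin N) (Fin N) ℂ, (∀ b, star (Z b) = -Z b) → (∀ (j : ℕ) (c : PBond P j), I j c → bondAvgIter j Z c = 0) →
        ∀ (j : ℕ) (c : PBond P j), I j c →
          dIterL j (1 : PBond P 0 → Matrix (Fin N) (Fin N) ℂ) (fun b => Z b + (T Z b.tgt - T Z b.src)) c = 0) := by
  classical
  obtain ⟨Λ, hΛ0, hΛs⟩ := exists_combFamily (P := P) (n := Fin N)
  -- the touched centres, as a predicate on fine sites with a Σ-witness
  let Tch : Site P 0 → Prop := fun x => ∃ p : (j : ℕ) × Site P j, (∃ b : PBond P p.1, I p.1 b ∧ (p.2 = b.src ∨ p.2 = b.tgt)) ∧ embIter p.1 p.2 = x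
  let Tfun : (PBond P 0 → Matrix (Fin N) (Fin N) ℂ) → Site P 0 → Matrix (Fin N) (Fin N) ℂ := fun Z x =>
    if h : Tch x then Λ h.choose.1 Z h.choose.2 else 0
  have hT_apply : ∀ Z x, Tfun Z x = if h : Tch x then Λ h.choose.1 Z h.choose.2 else 0 := fun _ _ => rfl
  -- the KEY: on print's kernel the value at a touched centre is the comb functional of THAT touched site
  have hkey : ∀ Z : PBond P 0 → Matrix (Fin N) (Fin N) ℂ, (∀ (j : ℕ) (c : PBond P j), I j c → bondAvgIter j Z c = 0) →
      ∀ (j : ℕ) (b : PBond P j) (y : Site P j), I j b → (y = b.src ∨ y = b.tgt) → Tfun Z (embIter j y) = Λ j Z y := by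
    intro Z h0 j b y hb hyb
    have hx : Tch (embIter j y) := ⟨⟨j, y⟩, ⟨b, hb, hyb⟩, rfl⟩
    rw [hT_apply, dif_pos hx]
    -- compare the chosen touched site `(j₁, y₁)` with `(j, y)`
    have hspec := hx.choose_spec
    generalize hx.choose = p at hspec ⊢
    obtain ⟨j₁, y₁⟩ := p
    obtain ⟨⟨b₁, hb₁, hyb₁⟩, heq⟩ := hspec
    rcases lt_trichotomy j₁ j with hlt | heq' | hgt
    · exact comb_eq_of_collision D hcollar hI₁ hI₂ Λ hΛs h0 hb₁ hb hyb₁ hyb hlt heq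
    · -- same level: same site
      have hjP : j ≤ P.m + P.K := by
        rcases hI₁ j b hb with h | h <;> exact (D.le_of_lamSite h).trans D.hk
      subst heq'
      obtain rfl : y₁ = y := embIter_injective hjP heq
      rfl
    · exact (comb_eq_of_collision D hcollar hI₁ hI₂ Λ hΛs h0 hb hb₁ hyb hyb₁ hgt heq.symm).symm
  refine ⟨{ toFun := Tfun, map_add' := fun Z Z' => ?_, map_smul' := fun a Z => ?_ }, ?_, ?_, ?_, ?_, ?_, ?_, ?_⟩
  · funext x
    simp only [hT_apply, Pi.add_apply]
    split_ifs with h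
    · exact combFamily_add Λ hΛ0 hΛs _ Z Z' _
    · rw [add_zero]
  · funext x
    simp only [hT_apply, Pi.smul_apply, RingHom.id_apply]
    split_ifs with h
    · exact combFamily_const_smul Λ hΛ0 hΛs a _ Z _
    · rw [smul_zero]
  · -- skew
    intro Z hZ x
    show star (Tfun Z x) = -Tfun Z x
    rw [hT_apply]
    split_ifs with h
    · exact combFamily_skew Λ hΛ0 hΛs hZ _ _
    · rw [star_zero, neg_zero]
  · -- 𝔰𝔲(N)
    intro Z hZ x
    show Tfun Z x ∈ lieSU (Fin N)
    rw [hT_apply]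
    split_ifs with h
    · exact combFamily_mem_lieSU Λ hΛ0 hΛs hZ _ _
    · exact Submodule.zero_mem _
  · -- support
    intro Z x hx
    show Tfun Z x = 0
    rw [hT_apply, dif_neg]
    rintro ⟨⟨j, y⟩, ⟨b, hb, hyb⟩, heq⟩
    exact hx ⟨j, b, y, hb, hyb, heq⟩
  · -- centre values for every comb family
    intro Λ' hΛ'0 hΛ's Z h0 j b y hb hyb
    show Tfun Z (embIter j y) = Λ' j Z y
    rw [hkey Z h0 j b y hb hyb, combFamily_unique Λ hΛ0 hΛs Λ' hΛ'0 hΛ's]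
  · -- dichotomy: zero, or the comb value of a touched site centred at `x`
    intro Λ' hΛ'0 hΛ's Z x
    show Tfun Z x = 0 ∨ _
    rw [hT_apply]
    by_cases h : Tch x
    · rw [dif_pos h]
      obtain ⟨⟨b, hb, hyb⟩, heq⟩ := h.choose_spec
      exact Or.inr ⟨h.choose.1, b, h.choose.2, hb, hyb, heq, by
        show Tfun Z x = _
        rw [hT_apply, dif_pos h, combFamily_unique Λ hΛ0 hΛs Λ' hΛ'0 hΛ's]⟩
    · rw [dif_neg h]; exact Or.inl rfl
  · -- the sup letter
    intro Z s hs hZs x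
    show ‖Tfun Z x‖ ≤ _
    rw [hT_apply]
    split_ifs with h
    · obtain ⟨⟨b, hb, -⟩, -⟩ := h.choose_spec
      have hjk : h.choose.1 ≤ D.k := by rcases hI₁ _ b hb with h' | h' <;> exact D.le_of_lamSite h'
      refine (K0Stub1TouchedCentresOfDomains.norm_combFamily_le' Λ hΛ0 hΛs hs hZs _ _).trans ?_
      have hL1 : (1 : ℝ) ≤ P.L := by exact_mod_cast P.L_pos
      have hd : (0 : ℝ) ≤ ((P.d + 2 : ℕ) : ℝ) := Nat.cast_nonneg _
      exact mul_le_mul_of_nonneg_right (mul_le_mul_of_nonneg_left (pow_le_pow_right₀ hL1 (by omega)) hd) hs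
    · rw [norm_zero]; positivity
  · -- the record's kernel
    intro Z hZ h0 j c hc
    show dIterL j (1 : PBond P 0 → Matrix (Fin N) (Fin N) ℂ) (fun b => Z b + (Tfun Z b.tgt - Tfun Z b.src)) c = 0
    have hskew : ∀ x, star (Tfun Z x) = -Tfun Z x := fun x => by
      rw [hT_apply]
      split_ifs with h
      · exact combFamily_skew Λ hΛ0 hΛs hZ _ _
      · rw [star_zero, neg_zero]
    have hadd : (fun b => Z b + (Tfun Z b.tgt - Tfun Z b.src)) = Z + fun b : PBond P 0 => Tfun Z b.tgt - Tfun Z b.src := rfl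
    rw [hadd, map_add, Pi.add_apply, dIterL_one_eq_sub_comb Λ hΛ0 hΛs hZ j c, h0 j c hc, smul_zero, zero_sub, dIterL_one_grad hskew j c,
      hkey Z h0 j c c.tgt hc (Or.inr rfl), hkey Z h0 j c c.src hc (Or.inl rfl)]
    abel

include hcollar hI₁ hI₂ in
/-- ★★ **THE MULTI-LEVEL FLAT AVERAGING DICTIONARY (∃ν form, the shape of p602768 §3).**  For every nested `D` with the collar property, every index reading `I`
and every SKEW `Z` with `(Q_jZ)(c) = 0` at every index bond: ONE skew gauge function `ν` (𝔰𝔲(N)-valued if `Z` is; `= Λ_jZ` at the touched `j`-centres) with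
`Q_j(1)(Z + ∂ν)(c) = 0` at every index bond, all levels at once. [cite: Balaban1985Variational, (44)-(47) p.285; Balaban1984PropagatorsII, (2.3) p.224, (2.20) p.226; Balaban1985Averaging, (11) p.18, (62) p.28] -/
theorem exists_gauge_dIterL_one_eq_zero_of_bondAvgIter_eq_zero_levels {Z : PBond P 0 → Matrix (Fin N) (Fin N) ℂ} (hZ : ∀ b, star (Z b) = -Z b)
    (h0 : ∀ (j : ℕ) (c : PBond P j), I j c → bondAvgIter j Z c = 0) :
    ∃ nu : Site P 0 → Matrix (Fin N) (Fin N) ℂ,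
      (∀ x, star (nu x) = -nu x) ∧
      (∀ (j : ℕ) (c : PBond P j), I j c → dIterL j (1 : PBond P 0 → Matrix (Fin N) (Fin N) ℂ) (fun b => Z b + (nu b.tgt - nu b.src)) c = 0) ∧
      ((∀ b, Z b ∈ lieSU (Fin N)) → ∀ x, nu x ∈ lieSU (Fin N)) ∧
      (∀ (Λ : (i : ℕ) → (PBond P 0 → Matrix (Fin N) (Fin N) ℂ) → Site P i → Matrix (Fin N) (Fin N) ℂ),
        (∀ Y y, Λ 0 Y y = 0) →
        (∀ (i : ℕ) (Y : PBond P 0 → Matrix (Fin N) (Fin N) ℂ) (y : Site P (i + 1)),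
          Λ (i + 1) Y y = (P.L ^ i : ℕ) • combMean (bondAvgIter i Y) y + Λ i Y (emb y)) →
        ∀ (j : ℕ) (b : PBond P j) (y : Site P j), I j b → (y = b.src ∨ y = b.tgt) → nu (embIter j y) = Λ j Z y) ∧
      (∀ s : ℝ, 0 ≤ s → (∀ b, ‖Z b‖ ≤ s) → ∀ x, ‖nu x‖ ≤ ((P.d + 2 : ℕ) : ℝ) * (P.L : ℝ) ^ (D.k + 1) * s) := by
  obtain ⟨T, hskew, hsu, -, hcentre, -, hletter, hker⟩ :=
    exists_linear_gauge_dIterL_one_eq_zero_of_bondAvgIter_eq_zero (N := N) D hcollar I hI₁ hI₂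
  exact ⟨T Z, hskew Z hZ, hker Z hZ h0, fun hZsu => hsu Z hZsu, fun Λ hΛ0 hΛs => hcentre Λ hΛ0 hΛs Z h0, fun s hs hZs => hletter Z s hs hZs⟩

include hcollar hI₁ hI₂ in
/-- ★★ **THE TEST-SIDE TRANSFER OF AN ANNIHILATOR (the (127)_record ⇒ (127)_print junction, exact part).**  An additive functional `ℓ` of fine fields that vanishes on the
RECORD's skew multi-level kernel (`Q_j(1)Y = 0` at every index bond — the shape in which dag-n07-w2's chart delivers the record's criticality, `fderiv_msChart_apply_eq_zero_iff`)
takes on every skew `Z` of PRINT's multi-level kernel the value `ℓ Z = −ℓ(∂ν)` of (minus) a skew PURE GAUGE `∂ν`, `ν = TZ` (𝔰𝔲(N)-valued if `Z` is) — the source of the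
corrected current `w′ = w + (∂∘T)ᵀw` of HANDOFF § g4 (t1)(ii) (the transpose is the (98)-slot supplier's, not taken here).
[cite: Balaban1985Variational, (127)-(128) p.297, (44)-(47) p.285; Balaban1984PropagatorsII, (2.6)-(2.7) p.224] -/
theorem apply_eq_neg_apply_grad_of_annihilates_record_kernel {W : Type*} [AddCommGroup W] (ℓ : (PBond P 0 → Matrix (Fin N) (Fin N) ℂ) →+ W)
    (hℓ : ∀ Y : PBond P 0 → Matrix (Fin N) (Fin N) ℂ, (∀ b, star (Y b) = -Y b) →
      (∀ (j : ℕ) (c : PBond P j), I j c → dIterL j (1 : PBond P 0 → Matrix (Fin N) (Fin N) ℂ) Y c = 0) → ℓ Y = 0)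
    {Z : PBond P 0 → Matrix (Fin N) (Fin N) ℂ} (hZ : ∀ b, star (Z b) = -Z b) (h0 : ∀ (j : ℕ) (c : PBond P j), I j c → bondAvgIter j Z c = 0) :
    ∃ nu : Site P 0 → Matrix (Fin N) (Fin N) ℂ, (∀ x, star (nu x) = -nu x) ∧ ((∀ b, Z b ∈ lieSU (Fin N)) → ∀ x, nu x ∈ lieSU (Fin N)) ∧
      ℓ Z = -ℓ (fun b => nu b.tgt - nu b.src) := by
  obtain ⟨nu, hnu, hker, hsu, -, -⟩ := exists_gauge_dIterL_one_eq_zero_of_bondAvgIter_eq_zero_levels D hcollar I hI₁ hI₂ hZ h0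
  have hY : ∀ b : PBond P 0, star (Z b + (nu b.tgt - nu b.src)) = -(Z b + (nu b.tgt - nu b.src)) := fun b => by
    rw [star_add, star_sub, hZ, hnu, hnu]; abel
  have h1 := hℓ _ hY hker
  rw [show (fun b => Z b + (nu b.tgt - nu b.src)) = Z + fun b : PBond P 0 => nu b.tgt - nu b.src from rfl, map_add] at h1
  exact ⟨nu, hnu, hsu, eq_neg_of_add_eq_zero_left h1⟩

include hcollar hI₁ hI₂ in
/-- ★ **GAUGE-BLIND READERS: an additive functional killing every skew pure gauge and the record's skew multi-level kernel kills print's skew multi-level kernel**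
(the multi-level, one-directional edition of p602768 `annihilates_ker_dIterL_one_iff`). [cite: Balaban1985Variational, (4) p.278, (44)-(47) p.285; Balaban1984PropagatorsII, (2.6)-(2.7) p.224] -/
theorem annihilates_print_kernel_of_record_kernel {W : Type*} [AddCommGroup W] (ℓ : (PBond P 0 → Matrix (Fin N) (Fin N) ℂ) →+ W)
    (hℓμ : ∀ μ : Site P 0 → Matrix (Fin N) (Fin N) ℂ, (∀ x, star (μ x) = -μ x) → ℓ (fun b => μ b.tgt - μ b.src) = 0)
    (hℓ : ∀ Y : PBond P 0 → Matrix (Fin N) (Fin N) ℂ, (∀ b, star (Y b) = -Y b) →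
      (∀ (j : ℕ) (c : PBond P j), I j c → dIterL j (1 : PBond P 0 → Matrix (Fin N) (Fin N) ℂ) Y c = 0) → ℓ Y = 0)
    {Z : PBond P 0 → Matrix (Fin N) (Fin N) ℂ} (hZ : ∀ b, star (Z b) = -Z b) (h0 : ∀ (j : ℕ) (c : PBond P j), I j c → bondAvgIter j Z c = 0) :
    ℓ Z = 0 := by
  obtain ⟨nu, hnu, -, h⟩ := apply_eq_neg_apply_grad_of_annihilates_record_kernel D hcollar I hI₁ hI₂ ℓ hℓ hZ h0
  rw [h, hℓμ nu hnu, neg_zero]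

end Main

/-! ## §4  The two printed readings: [B6] (2.3) `Λ_j`-bonds (= `BondIdx D`, the heart's `Q_V`) and B15 reading (b) `bondsOf∘genSet` (the record's fibre); (2.2) -/

section Readings

variable [NeZero N] (D : Domains P)

/-- A (2.3)-bond has a `Λ_j`-site end-point (the one inside `Ω_j^{(j)}`). [cite: Balaban1984PropagatorsII, (2.3) p.224] -/
theorem lamSite_or_of_lamBond {j : ℕ} {b : PBond P j} (hb : D.LamBond j b) : D.LamSite j b.src ∨ D.LamSite j b.tgt := by
  obtain ⟨h | h, hs, ht⟩ := hb
  · exact Or.inl ⟨h, hs⟩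
  · exact Or.inr ⟨h, ht⟩

/-- ★★ **THE DICTIONARY FOR [B6] (2.3)'s INDEX BONDS** (`I = LamBond`, the index set `BondIdx D` of lit-balaban's multi-level `QE D` ∕ this seat's `Q_V`): collar property,
`Z` skew with `Q_jZ = 0` on `Λ_j` for all `j` ⇒ ONE skew gauge function with `Q_j(1)(Z + ∂ν) = 0` on `Λ_j` for all `j`.
[cite: Balaban1984PropagatorsII, (2.3) p.224, (2.6) p.224, (2.20) p.226; Balaban1985Variational, (44)-(47) p.285] -/
theorem exists_gauge_dIterL_one_eq_zero_of_constr_zero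
    (hcollar : ∀ (i : ℕ) (e : PBond P (i + 1)), D.LamBond (i + 1) e → ∀ z : Site P i, (blockOf z = e.src ∨ blockOf z = e.tgt) → z ∈ D.Om i)
    {Z : PBond P 0 → Matrix (Fin N) (Fin N) ℂ} (hZ : ∀ b, star (Z b) = -Z b)
    (h0 : ∀ (j : ℕ) (c : PBond P j), D.LamBond j c → bondAvgIter j Z c = 0) :
    ∃ nu : Site P 0 → Matrix (Fin N) (Fin N) ℂ,
      (∀ x, star (nu x) = -nu x) ∧
      (∀ (j : ℕ) (c : PBond P j), D.LamBond j c → dIterL j (1 : PBond P 0 → Matrix (Fin N) (Fin N) ℂ) (fun b => Z b + (nu b.tgt - nu b.src)) c = 0) ∧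
      ((∀ b, Z b ∈ lieSU (Fin N)) → ∀ x, nu x ∈ lieSU (Fin N)) := by
  obtain ⟨nu, h1, h2, h3, -, -⟩ := exists_gauge_dIterL_one_eq_zero_of_bondAvgIter_eq_zero_levels D hcollar (fun j b => D.LamBond j b)
    (fun j b hb => lamSite_or_of_lamBond D hb) (fun j c hs ht => ⟨Or.inl hs.1, hs.2, ht.2⟩) hZ h0
  exact ⟨nu, h1, h2, h3⟩

open B6SectAOperatorsV1 (BondIdx QE)

/-- ★★ **THE SAME IN THE (128) LETTER `Q_V` OF THIS SEAT's HEART FILES** (p595460's kernel-formula extension of `QE D`; hypothesis `Q_VZ = 0` read through p602768 §1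
`QV_eq_zero_iff`): collar property, `Z` skew with `Q_VZ = 0` ⇒ ONE skew gauge function with `Q_j(1)(Z + ∂ν)(c) = 0` at every `(j, c) ∈ BondIdx D`.
[cite: Balaban1984PropagatorsII, (2.20) p.226; Balaban1985Variational, (127)-(128) p.297, (44)-(47) p.285] -/
theorem exists_gauge_dIterL_one_eq_zero_of_QV_eq_zero
    (hcollar : ∀ (i : ℕ) (e : PBond P (i + 1)), D.LamBond (i + 1) e → ∀ z : Site P i, (blockOf z = e.src ∨ blockOf z = e.tgt) → z ∈ D.Om i)
    {instDE : DecidableEq (PBond P 0)}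
    {QV : (PBond P 0 → Matrix (Fin N) (Fin N) ℂ) →ₗ[ℂ] (BondIdx D → Matrix (Fin N) (Fin N) ℂ)}
    (hQV : ∀ (A : PBond P 0 → Matrix (Fin N) (Fin N) ℂ) (t : BondIdx D),
      QV A t = ∑ j, ((WithLp.ofLp (QE D (WithLp.toLp 2 (Pi.single j 1))) t : ℝ) : ℂ) • A j)
    {Z : PBond P 0 → Matrix (Fin N) (Fin N) ℂ} (hZ : ∀ b, star (Z b) = -Z b) (hQ : QV Z = 0) :
    ∃ nu : Site P 0 → Matrix (Fin N) (Fin N) ℂ,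
      (∀ x, star (nu x) = -nu x) ∧
      (∀ t : BondIdx D, dIterL (t.1.1 : ℕ) (1 : PBond P 0 → Matrix (Fin N) (Fin N) ℂ) (fun b => Z b + (nu b.tgt - nu b.src)) t.1.2 = 0) ∧
      ((∀ b, Z b ∈ lieSU (Fin N)) → ∀ x, nu x ∈ lieSU (Fin N)) := by
  have h0' := (K0Stub1FlatAveragingDictionary.QV_eq_zero_iff D hQV Z).1 hQ
  have h0 : ∀ (j : ℕ) (c : PBond P j), D.LamBond j c → bondAvgIter j Z c = 0 := fun j c hc =>
    h0' ⟨⟨⟨j, Nat.lt_succ_of_le (D.le_of_lamBond hc)⟩, c⟩, hc⟩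
  obtain ⟨nu, h1, h2, h3⟩ := exists_gauge_dIterL_one_eq_zero_of_constr_zero D hcollar hZ h0
  exact ⟨nu, h1, fun t => h2 _ _ t.2, h3⟩

/-- ★★ **THE DICTIONARY FOR B15 READING (b)** — the index set `bondsOf (genSet Ω k j)` of the record's fibre `AgreeOn (genSet s.Ω k)` (bonds MEETING `Γ_j`, incl. the inward
crossing bonds at `∂Ω_{j+1}`), for the regions `Ω_i = {x | D.InOm i x}` of a nested family with the collar property (dag-n07-w2's `mem_bondsOf_genSet_inOm_iff`:
`c ∈ bondsOf Γ_j ↔ Λ_j-site c₋ ∨ Λ_j-site c₊`): `Z` skew with `Q_jZ(c) = 0` on these bonds ⇒ ONE skew gauge function with `Q_j(1)(Z + ∂ν)(c) = 0` on the same bonds,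
i.e. `Z + ∂ν` is a multi-scale fibre tangent in the record's currency (dag-n07-w1 `fderiv_msChart_apply_eq_zero_iff`, at `U = 1`).
[cite: Balaban1988Convergent, (2.2) p.255, (2.10) p.256; Balaban1987RG1, (0.1) p.251; Balaban1985Variational, (44)-(47) p.285, (150) p.301] -/
theorem exists_gauge_dIterL_one_eq_zero_of_bondAvgIter_eq_zero_genSet
    (hcollar : ∀ (i : ℕ) (e : PBond P (i + 1)), D.LamBond (i + 1) e → ∀ z : Site P i, (blockOf z = e.src ∨ blockOf z = e.tgt) → z ∈ D.Om i)
    {Z : PBond P 0 → Matrix (Fin N) (Fin N) ℂ} (hZ : ∀ b, star (Z b) = -Z b)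
    (h0 : ∀ (j : ℕ), ∀ c ∈ bondsOf (genSet (fun i => {x : Site P 0 | D.InOm i x}) D.k j), bondAvgIter j Z c = 0) :
    ∃ nu : Site P 0 → Matrix (Fin N) (Fin N) ℂ,
      (∀ x, star (nu x) = -nu x) ∧
      (∀ (j : ℕ), ∀ c ∈ bondsOf (genSet (fun i => {x : Site P 0 | D.InOm i x}) D.k j),
        dIterL j (1 : PBond P 0 → Matrix (Fin N) (Fin N) ℂ) (fun b => Z b + (nu b.tgt - nu b.src)) c = 0) ∧
      ((∀ b, Z b ∈ lieSU (Fin N)) → ∀ x, nu x ∈ lieSU (Fin N)) := by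
  obtain ⟨nu, h1, h2, h3, -, -⟩ := exists_gauge_dIterL_one_eq_zero_of_bondAvgIter_eq_zero_levels D hcollar
    (fun j c => c ∈ bondsOf (genSet (fun i => {x : Site P 0 | D.InOm i x}) D.k j))
    (fun j b hb => (Node00.mem_bondsOf_genSet_inOm_iff D j b).1 hb) (fun j c hs ht => (Node00.mem_bondsOf_genSet_inOm_iff D j c).2 (Or.inl hs)) hZ h0
  exact ⟨nu, h1, h2, h3⟩

/-- `genSet Ω k` READS THE REGIONS ONLY AT `1 ≤ i ≤ k` (for `k ≥ 1`): two sequences agreeing there have the same determining set ([III] (2.2): `Γ₀ = Ω₁ᶜ`,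
`Γ_i = Ω_i ∖ Ω_{i+1}`, `Γ_k = Ω_k`). [cite: Balaban1988Convergent, (2.2) p.255] -/
theorem genSet_congr_pos {Ω Ω' : ℕ → Set (Site P 0)} {k : ℕ} (hk : 1 ≤ k) (h : ∀ i, 1 ≤ i → i ≤ k → Ω i = Ω' i) : genSet Ω k = genSet Ω' k := by
  funext i
  simp only [genSet, gammaRegion]
  split_ifs with h1 h2 h3
  · rfl
  · rw [h k hk le_rfl]
  · rw [h 1 le_rfl hk]
  · rw [h i (by omega) (by omega), h (i + 1) (by omega) (by omega)]

/-- ★★ **THE DICTIONARY FOR B15 READING (b) ON ANY REGION SEQUENCE `Ω` AGREEING WITH THE FAMILY's `B^i(Ω_i^{(i)})` AT `1 ≤ i ≤ k`** (`k ≥ 1`) — the shape of the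
record's `genSet s.Ω k` once a V1 family with `{x | InOm i x} = s.Ω i` is named (dag-n07-e's `domainsOfSeq s`, 44c).
[cite: Balaban1988Convergent, (2.2) p.255, (2.10) p.256; Balaban1985Variational, (44)-(47) p.285, (150) p.301] -/
theorem exists_gauge_dIterL_one_eq_zero_of_bondAvgIter_eq_zero_genSet_of_agree
    (hcollar : ∀ (i : ℕ) (e : PBond P (i + 1)), D.LamBond (i + 1) e → ∀ z : Site P i, (blockOf z = e.src ∨ blockOf z = e.tgt) → z ∈ D.Om i)
    {Ω : ℕ → Set (Site P 0)} (hk : 1 ≤ D.k) (hΩ : ∀ i, 1 ≤ i → i ≤ D.k → Ω i = {x : Site P 0 | D.InOm i x})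
    {Z : PBond P 0 → Matrix (Fin N) (Fin N) ℂ} (hZ : ∀ b, star (Z b) = -Z b)
    (h0 : ∀ (j : ℕ), ∀ c ∈ bondsOf (genSet Ω D.k j), bondAvgIter j Z c = 0) :
    ∃ nu : Site P 0 → Matrix (Fin N) (Fin N) ℂ,
      (∀ x, star (nu x) = -nu x) ∧
      (∀ (j : ℕ), ∀ c ∈ bondsOf (genSet Ω D.k j), dIterL j (1 : PBond P 0 → Matrix (Fin N) (Fin N) ℂ) (fun b => Z b + (nu b.tgt - nu b.src)) c = 0) ∧
      ((∀ b, Z b ∈ lieSU (Fin N)) → ∀ x, nu x ∈ lieSU (Fin N)) := by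
  rw [genSet_congr_pos hk hΩ] at h0 ⊢
  exact exists_gauge_dIterL_one_eq_zero_of_bondAvgIter_eq_zero_genSet D hcollar hZ h0

/-- ★ **(2.2)-ADMISSIBLE FAMILIES** (`Adm22 D R M` with `2L ≤ R·M + 1`, e.g. `R ≥ 2`, `L ∣ M` as at NODE 00's record; collar by UST `Prop8Chart.collar_of_adm22`):
the (2.3)-indexed dictionary. [cite: Balaban1984PropagatorsII, (2.1)-(2.3) p.224, (2.20) p.226; Balaban1985Variational, (44)-(47) p.285] -/
theorem exists_gauge_dIterL_one_eq_zero_of_constr_zero_of_adm22 {R M : ℕ} (hAdm : Adm22 D R M) (hRM : 2 * P.L ≤ R * M + 1)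
    {Z : PBond P 0 → Matrix (Fin N) (Fin N) ℂ} (hZ : ∀ b, star (Z b) = -Z b)
    (h0 : ∀ (j : ℕ) (c : PBond P j), D.LamBond j c → bondAvgIter j Z c = 0) :
    ∃ nu : Site P 0 → Matrix (Fin N) (Fin N) ℂ,
      (∀ x, star (nu x) = -nu x) ∧
      (∀ (j : ℕ) (c : PBond P j), D.LamBond j c → dIterL j (1 : PBond P 0 → Matrix (Fin N) (Fin N) ℂ) (fun b => Z b + (nu b.tgt - nu b.src)) c = 0) ∧
      ((∀ b, Z b ∈ lieSU (Fin N)) → ∀ x, nu x ∈ lieSU (Fin N)) :=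
  exists_gauge_dIterL_one_eq_zero_of_constr_zero D (Prop8Chart.collar_of_adm22 D hAdm hRM) hZ h0

/-- ★ **(2.2)-ADMISSIBLE FAMILIES**: the reading-(b) dictionary. [cite: Balaban1984PropagatorsII, (2.1)-(2.2) p.224; Balaban1988Convergent, (2.10) p.256; Balaban1985Variational, (44)-(47) p.285] -/
theorem exists_gauge_dIterL_one_eq_zero_of_bondAvgIter_eq_zero_genSet_of_adm22 {R M : ℕ} (hAdm : Adm22 D R M) (hRM : 2 * P.L ≤ R * M + 1)
    {Z : PBond P 0 → Matrix (Fin N) (Fin N) ℂ} (hZ : ∀ b, star (Z b) = -Z b)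
    (h0 : ∀ (j : ℕ), ∀ c ∈ bondsOf (genSet (fun i => {x : Site P 0 | D.InOm i x}) D.k j), bondAvgIter j Z c = 0) :
    ∃ nu : Site P 0 → Matrix (Fin N) (Fin N) ℂ,
      (∀ x, star (nu x) = -nu x) ∧
      (∀ (j : ℕ), ∀ c ∈ bondsOf (genSet (fun i => {x : Site P 0 | D.InOm i x}) D.k j),
        dIterL j (1 : PBond P 0 → Matrix (Fin N) (Fin N) ℂ) (fun b => Z b + (nu b.tgt - nu b.src)) c = 0) ∧
      ((∀ b, Z b ∈ lieSU (Fin N)) → ∀ x, nu x ∈ lieSU (Fin N)) :=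
  exists_gauge_dIterL_one_eq_zero_of_bondAvgIter_eq_zero_genSet D (Prop8Chart.collar_of_adm22 D hAdm hRM) hZ h0

end Readings

end Summit.QuantumFields.YangMills.Theorems.K0Stub1FlatAveragingDictionaryLevels

end
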